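import Summits.ValiantsHypothesis.ValiantsHypothesis.Theorems.LacunarySymmetroidMatrixDescartesVSQGenInv

/-!
# `MatrixDescartes` census — the ALL-`(m, K)` law: `ζ_sym(m,K) ≥ (m−1)(3K−6) + K − 1` for every `m ≥ 1`, `K ≥ 4` (`gen_law`)

HONEST FRAMING.  Val-V1-extremal engine seat val-v1x-eng-6 (g2), `--supports stmt-ValiantsHypothesis-18050`.  This file finishes the
induction (`inv_all`) for the recursive symmetric TRIDIAGONAL family `genL` of `…VSQGenDefs` and proves, for EVERY `m ≥ 1` and EVERY
`K ≥ 4`, `¬ PosRootLawAt m K ((m−1)(3K−6) + K − 2)` (`gen_law`): an explicit real symmetric `m × m` pencil with `K` exponents and at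
least `(m−1)(3K−6) + K − 1 = (3m−2)K − 6m + 5` distinct positive determinant zeros — slope `3m − 2` per exponent at fixed `m`, for
all `K`.  It contains the `m = 2` law `4K − 7` (`…VSQLaw`) and the `m = 3` law `7K − 13` (`…VSQTriLaw`) as the first cases (up to the
choice of family) and, at `m = 4, 5`, gives the slopes `10, 13` above the kernel's chain-ray slopes `28/3, 37/3` for all large `K`;
at `m = 6` it ties the tower slope `16`.  A fixed-`m`, all-`K` LOWER bound bears on the crux `MatrixDescartes` (stmt-18050: an UPPER
bound `2^{C K log K}` in the window `m ≤ 2^{polylog K}`) neither way — at `m ~ K` the count is only `~3K²`, polynomial; `VP ≠ VNP`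
is NOT proved.

MECHANISM (recursive «Viro patchworking + square splitting»).  `A_{L+1}(t) = [[a(t), B^{−δ}b(t)e₁ᵀ], [B^{−δ}b(t)e₁, (−1)^n A_L(t/B^σ)]]`,
`A_1 = [(−1)^n B^{−2δ} c]`: each of the `m − 1` bordered levels contributes `3K − 6` sign alternations (its `a`-chain, the crossing,
the `K − 3` split zeros of its link `b`, the crossing back), `σ = 4K − 4` later in `x = log_B t` than the previous level, and the last
level contributes the `K − 1` alternations of the `c`-chain; the continuant recurrence (`…VSQGenRec.fL_rec`) and the two-sided
invariant `2^{−L} Vv ≤ ss·fL ≤ 2^{L} Vv` (`…VSQGenStep0/1`, `…VSQGenInv`) carry the signs through the levels with base `B = 8K⁴4^m`.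
[folklore] Viro patchworking / dominance; continuants; intermediate value theorem.
-/

set_option linter.dupNamespace false
set_option autoImplicit false

namespace Summit.ValiantsHypothesis.ValiantsHypothesis.Theorems.LacunarySymmetroidMatrixDescartes.VSQ

open scoped BigOperators
open Finset Polynomial
open Summit.ValiantsHypothesis.ValiantsHypothesis.Theorems.MatrixDescartes.Negative (PosRootLawAt)
open Summit.ValiantsHypothesis.ValiantsHypothesis.Theorems.SymmetroidDescartes (le_card_posRoots_of_alternating)

variable {n : ℕ} {B : ℝ}

/-! ## 1. The induction -/

/-- **the invariant at all levels `L ≤ m + 1`** (`B ≥ 16K²`, `B ≥ 8K⁴4^m`). [folklore] -/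
theorem inv_pair (hn : 2 ≤ n) (hB : 16 * ((n + 2 : ℕ) : ℝ) ^ 2 ≤ B) {m : ℕ} (hBm : 8 * ((n + 2 : ℕ) : ℝ) ^ 4 * 4 ^ m ≤ B) :
    ∀ L : ℕ, L ≤ m → (INVf n B L ∧ INVp n B L) ∧ (INVf n B (L + 1) ∧ INVp n B (L + 1))
  | 0, _ => ⟨inv_zero n B, invf_one hn hB, invp_one hn hB⟩
  | L + 1, hL => by
    obtain ⟨⟨I0f, I0p⟩, I1f, I1p⟩ := inv_pair hn hB hBm L (by omega)
    have hK1 : (1 : ℝ) ≤ ((n + 2 : ℕ) : ℝ) := by exact_mod_cast (show 1 ≤ n + 2 by omega)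
    have h4 : (4 : ℝ) ^ L ≤ 4 ^ m := pow_le_pow_right₀ (by norm_num) (by omega)
    have hBL4 : 8 * ((n + 2 : ℕ) : ℝ) ^ 4 * 4 ^ L ≤ B := le_trans (mul_le_mul_of_nonneg_left h4 (by positivity)) hBm
    have hBL : 8 * ((n + 2 : ℕ) : ℝ) ^ 2 * 4 ^ L ≤ B := by
      refine le_trans ?_ hBL4
      have : ((n + 2 : ℕ) : ℝ) ^ 2 ≤ ((n + 2 : ℕ) : ℝ) ^ 4 := pow_le_pow_right₀ hK1 (by norm_num)
      nlinarith [pow_pos (show (0:ℝ) < 4 by norm_num) L]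
    exact ⟨⟨I1f, I1p⟩, step_flat hn hB hBL I0f I1f, step_points hn hB hBL4 I0f I1f I0p I1p⟩

/-! ## 2. Signs alternate, points increase -/

/-- the flat sign one level up. [folklore] -/
theorem sflat_succ (n : ℕ) : ∀ L : ℕ, sflat n (L + 1) = (-1) ^ n * ((-1) ^ n) ^ L * sflat n L
  | 0 => by simp [sflat]
  | L + 1 => rfl

/-- **closed form of the signs**: `ss L j = (−1)^j · sflat L` (`L ≥ 1`, `j < npts L`). [folklore] -/
theorem ss_eq (hn : 2 ≤ n) : ∀ (L j : ℕ), j < npts n (L + 1) → ss n (L + 1) j = (-1) ^ j * sflat n (L + 1)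
  | 0, j, hj => by
    have hjn : j ≤ n + 1 := by simp [npts] at hj; omega
    show (-1 : ℝ) ^ n * scR n j = (-1) ^ j * sflat n 1
    simp only [sflat]
    rcases Nat.eq_zero_or_pos j with h0 | hj0
    · subst h0; rw [scR_zero]; simp
    · by_cases hjn' : j ≤ n
      · rw [scR_blk hj0 hjn']; ring
      · have hj' : j = n + 1 := by omega
        subst hj'; rw [scR_top]; ring
  | L + 1, j, hj => by
    rw [sflat_succ n (L + 1)]
    by_cases h3 : j < 3 * n
    · by_cases hjn : j ≤ n
      · rw [ss_U n L j h3 hjn]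
        have : saR n j = (-1) ^ (n + j) := by
          rcases Nat.eq_zero_or_pos j with h0 | hj0
          · subst h0; rw [saR_zero]; simp
          · rw [saR_blk hj0 hjn]
        rw [this, pow_add]; ring
      · by_cases hp : (j - n) % 2 = 0
        · rw [ss_I n L j h3 hjn hp]
          obtain ⟨w, hw⟩ : ∃ w, j = n + 2 * w := ⟨(j - n) / 2, by omega⟩
          subst hw
          rcases neg_one_pow_eq_or ℝ n with h1 | h1 <;> rcases neg_one_pow_eq_or ℝ L with h2 | h2 <;>
            simp [h1, h2, pow_add, pow_mul, pow_succ]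
        · rw [ss_W n L j h3 hjn hp, sflat_succ n L]
          obtain ⟨w, hw⟩ : ∃ w, j = 2 * w + 1 + n := ⟨(j - n - 1) / 2, by omega⟩
          subst hw
          rcases neg_one_pow_eq_or ℝ n with h1 | h1 <;> rcases neg_one_pow_eq_or ℝ L with h2 | h2 <;>
            simp [h1, h2, pow_add, pow_mul, pow_succ]
    · rw [ss_late n L j h3, ss_eq hn L (j - 3 * n) (by rw [show L + 1 + 1 = L + 2 from rfl, npts_succ_succ] at hj; omega)]
      obtain ⟨j', hj'⟩ : ∃ j', j = 3 * n + j' := ⟨j - 3 * n, by omega⟩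
      subst hj'
      rw [show 3 * n + j' - 3 * n = j' by omega, show 3 * n + j' = j' + n + 2 * n by ring]
      rcases neg_one_pow_eq_or ℝ n with h1 | h1 <;> rcases neg_one_pow_eq_or ℝ L with h2 | h2 <;>
        simp [h1, h2, pow_add, pow_mul, pow_succ]

/-- the points increase (`L ≥ 1`). [folklore] -/
theorem tp_lt_succ (hn : 2 ≤ n) (hB : 16 * ((n + 2 : ℕ) : ℝ) ^ 2 ≤ B) :
    ∀ (L j : ℕ), j + 1 < npts n (L + 1) → tp n B (L + 1) j < tp n B (L + 1) (j + 1)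
  | 0, j, hj => by
    obtain ⟨hB1, -, -⟩ := hB16 hB
    show B ^ ((sg n : ℤ) - 1 + 2 * j) < B ^ ((sg n : ℤ) - 1 + 2 * (j + 1 : ℕ))
    exact zpow_lt_zpow_right₀ hB1 (by push_cast; linarith)
  | L + 1, j, hj => by
    obtain ⟨hB1, -, hB4⟩ := hB16 hB
    have hB0 : 0 < B := lt_trans zero_lt_one hB1
    rw [show L + 1 + 1 = L + 2 from rfl, npts_succ_succ] at hj
    by_cases h3 : j + 1 < 3 * n
    · rw [tp_lt3 n B L j (by omega), tp_lt3 n B L (j + 1) h3]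
      exact Summit.ValiantsHypothesis.ValiantsHypothesis.Theorems.LacunarySymmetroidMatrixDescartes.VSQ.tau_lt_succ hn hB4 j (by omega)
    · by_cases h3' : j < 3 * n
      · -- boundary: j = 3n − 1
        have hj3 : j = 3 * n - 1 := by omega
        rw [tp_lt3 n B L j h3', tp_ge3 n B L (j + 1) h3, hj3, tau_last hn, show 3 * n - 1 + 1 - 3 * n = 0 by omega]
        have h0 := tp_ge hn hB L 0 (by omega)
        calc B ^ (4 * (n : ℤ) - 1) < B ^ (sg n : ℤ) * B ^ (-1 : ℤ) := by
              rw [← zpow_add₀ hB0.ne']; exact zpow_lt_zpow_right₀ hB1 (by rw [sg_cast]; linarith)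
          _ ≤ B ^ (sg n : ℤ) * tp n B (L + 1) 0 := mul_le_mul_of_nonneg_left h0 (zpow_pos hB0 _).le
      · rw [tp_ge3 n B L j h3', tp_ge3 n B L (j + 1) h3, show j + 1 - 3 * n = (j - 3 * n) + 1 by omega]
        exact mul_lt_mul_of_pos_left (tp_lt_succ hn hB L (j - 3 * n) (by omega)) (zpow_pos hB0 _)

/-- the number of points in closed form. [folklore] -/
theorem npts_eq (n : ℕ) : ∀ L : ℕ, npts n (L + 1) = 3 * n * L + n + 2
  | 0 => by simp [npts]
  | L + 1 => by rw [show L + 1 + 1 = L + 2 from rfl, npts_succ_succ, npts_eq n L]; ring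

/-! ## 3. The count and the law -/

/-- the pencil determinant of the `L`-level family evaluates to `fL`. [folklore] -/
theorem eval_det_genL (n : ℕ) (B : ℝ) (L : ℕ) (t : ℝ) :
    ((∑ l, (X : ℝ[X]) ^ dF n l • (genL n B L l).map Polynomial.C).det).eval t = fL n B L t := by
  rw [Summit.ValiantsHypothesis.ValiantsHypothesis.Theorems.SymmetroidDescartes.eval_det_pencil]; rfl

/-- **`3nL + n + 1 = L(3K−6) + K − 1` distinct positive zeros** for the `(L+1)`-level family (`K = n + 2`, `n ≥ 2`, `B ≥ 16K²`,
`B ≥ 8K⁴4^L`). [folklore] -/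
theorem card_posRoots_ge_gen (hn : 2 ≤ n) (hB : 16 * ((n + 2 : ℕ) : ℝ) ^ 2 ≤ B) {L : ℕ}
    (hBm : 8 * ((n + 2 : ℕ) : ℝ) ^ 4 * 4 ^ L ≤ B) :
    3 * n * L + n + 1 ≤ ((∑ l, (X : ℝ[X]) ^ dF n l • (genL n B (L + 1) l).map Polynomial.C).det.roots.toFinset.filter
      (fun t => 0 < t)).card := by
  have hB0 : 0 < B := lt_trans zero_lt_one (hB16 hB).1
  have IP : INVp n B (L + 1) := ((inv_pair hn hB hBm L le_rfl).2).2
  refine le_card_posRoots_of_alternating _ (3 * n * L + n + 1) (fun j => tp n B (L + 1) j)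
    (Fin.strictMono_iff_lt_succ.2 fun i => ?_) (fun j => ?_) fun j => ?_
  · simpa using tp_lt_succ hn hB L i (by rw [npts_eq]; have := i.isLt; omega)
  · exact lt_of_lt_of_le (zpow_pos hB0 _) (tp_ge hn hB L j (by rw [npts_eq]; have := j.isLt; omega))
  · have hj1 : (j : ℕ) + 1 < npts n (L + 1) := by rw [npts_eq]; have := j.isLt; omega
    have hj0 : (j : ℕ) < npts n (L + 1) := by omega
    have h1 := IP j hj0
    have h2 := IP (j + 1) hj1
    rw [eval_det_genL, eval_det_genL]
    simp only [Fin.val_castSucc, Fin.val_succ]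
    rw [ss_eq hn L _ hj0] at h1
    rw [ss_eq hn L _ hj1, pow_succ] at h2
    have hV0 := Vv_pos hn hB (L + 1) _ hj0
    have hV1 := Vv_pos hn hB (L + 1) _ hj1
    have hlo : (0 : ℝ) < (1 / 2 : ℝ) ^ (L + 1) := by positivity
    have hsf : sflat n (L + 1) * sflat n (L + 1) = 1 := by
      rw [← abs_mul_abs_self, abs_sflat]; norm_num
    have hsq : (-1 : ℝ) ^ (j : ℕ) * (-1 : ℝ) ^ (j : ℕ) = 1 := by rw [← pow_add, ← two_mul, pow_mul]; norm_num
    -- (−1)^j sf · f_j ≥ lo V₀ > 0 and (−1)^j (−1) sf · f_{j+1} ≥ lo V₁ > 0 ⇒ f_j f_{j+1} < 0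
    have p1 : 0 < (-1 : ℝ) ^ (j : ℕ) * sflat n (L + 1) * fL n B (L + 1) (tp n B (L + 1) j) := lt_of_lt_of_le (by positivity) h1.1
    have p2 : 0 < (-1 : ℝ) ^ (j : ℕ) * (-1) * sflat n (L + 1) * fL n B (L + 1) (tp n B (L + 1) (j + 1)) :=
      lt_of_lt_of_le (by positivity) h2.1
    have e : ((-1 : ℝ) ^ (j : ℕ) * sflat n (L + 1) * fL n B (L + 1) (tp n B (L + 1) j)) *
        ((-1 : ℝ) ^ (j : ℕ) * (-1) * sflat n (L + 1) * fL n B (L + 1) (tp n B (L + 1) (j + 1))) =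
        -(fL n B (L + 1) (tp n B (L + 1) j) * fL n B (L + 1) (tp n B (L + 1) (j + 1))) := by
      linear_combination (-(fL n B (L + 1) (tp n B (L + 1) j) * fL n B (L + 1) (tp n B (L + 1) (j + 1))) *
          (sflat n (L + 1) * sflat n (L + 1))) * hsq +
        (-(fL n B (L + 1) (tp n B (L + 1) j) * fL n B (L + 1) (tp n B (L + 1) (j + 1)))) * hsf
    nlinarith [mul_pos p1 p2]

/-- **`ζ_sym(m,K) ≥ (m−1)(3K−6) + K − 1` for every `m ≥ 1` and every `K ≥ 4`**: the row `PosRootLawAt m K ((m−1)(3K−6) + K − 2)` is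
FALSE. [folklore] -/
theorem gen_law (m K : ℕ) (hm : 1 ≤ m) (hK : 4 ≤ K) : ¬ PosRootLawAt m K ((m - 1) * (3 * K - 6) + K - 2) := by
  obtain ⟨n, rfl⟩ : ∃ n, K = n + 2 := ⟨K - 2, by omega⟩
  obtain ⟨L, rfl⟩ : ∃ L, m = L + 1 := ⟨m - 1, by omega⟩
  have hn : 2 ≤ n := by omega
  set B : ℝ := 8 * ((n + 2 : ℕ) : ℝ) ^ 4 * 4 ^ L with hBdef
  have hK4 : (4 : ℝ) ≤ ((n + 2 : ℕ) : ℝ) := by exact_mod_cast (show 4 ≤ n + 2 by omega)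
  have hB : 16 * ((n + 2 : ℕ) : ℝ) ^ 2 ≤ B := by
    rw [hBdef]
    have h4 : (1 : ℝ) ≤ 4 ^ L := one_le_pow₀ (by norm_num)
    have hK16 : (16 : ℝ) ≤ ((n + 2 : ℕ) : ℝ) ^ 2 := by nlinarith
    have hsq : 16 * ((n + 2 : ℕ) : ℝ) ^ 2 ≤ ((n + 2 : ℕ) : ℝ) ^ 4 := by
      rw [show ((n + 2 : ℕ) : ℝ) ^ 4 = ((n + 2 : ℕ) : ℝ) ^ 2 * ((n + 2 : ℕ) : ℝ) ^ 2 by ring]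
      exact mul_le_mul_of_nonneg_right hK16 (sq_nonneg _)
    nlinarith [pow_pos (show (0:ℝ) < ((n + 2 : ℕ) : ℝ) by positivity) 4]
  intro h
  have h1 := h (dF n) (genL n B (L + 1)) (genL_isSymm n B (L + 1))
  have h2 := card_posRoots_ge_gen (B := B) hn hB (L := L) le_rfl
  have e : (L + 1 - 1) * (3 * (n + 2) - 6) + (n + 2) - 2 = 3 * n * L + n := by
    rw [show L + 1 - 1 = L by omega, show 3 * (n + 2) - 6 = 3 * n by omega]; ring_nf; omega
  rw [e] at h1
  omega

/-- the same in witness form. [folklore] -/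
theorem exists_pencil_gen (m K : ℕ) (hm : 1 ≤ m) (hK : 4 ≤ K) :
    ∃ (d : Fin K → ℕ) (S : Fin K → Matrix (Fin m) (Fin m) ℝ), (∀ l, (S l).IsSymm) ∧
      (m - 1) * (3 * K - 6) + K - 1 ≤ ((∑ l, (X : ℝ[X]) ^ d l • (S l).map Polynomial.C).det.roots.toFinset.filter
        (fun t => 0 < t)).card := by
  obtain ⟨n, rfl⟩ : ∃ n, K = n + 2 := ⟨K - 2, by omega⟩
  obtain ⟨L, rfl⟩ : ∃ L, m = L + 1 := ⟨m - 1, by omega⟩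
  have hn : 2 ≤ n := by omega
  set B : ℝ := 8 * ((n + 2 : ℕ) : ℝ) ^ 4 * 4 ^ L with hBdef
  have hB : 16 * ((n + 2 : ℕ) : ℝ) ^ 2 ≤ B := by
    rw [hBdef]
    have h4 : (1 : ℝ) ≤ 4 ^ L := one_le_pow₀ (by norm_num)
    have hK4 : (4 : ℝ) ≤ ((n + 2 : ℕ) : ℝ) := by exact_mod_cast (show 4 ≤ n + 2 by omega)
    have hK16 : (16 : ℝ) ≤ ((n + 2 : ℕ) : ℝ) ^ 2 := by nlinarith
    have hsq : 16 * ((n + 2 : ℕ) : ℝ) ^ 2 ≤ ((n + 2 : ℕ) : ℝ) ^ 4 := by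
      rw [show ((n + 2 : ℕ) : ℝ) ^ 4 = ((n + 2 : ℕ) : ℝ) ^ 2 * ((n + 2 : ℕ) : ℝ) ^ 2 by ring]
      exact mul_le_mul_of_nonneg_right hK16 (sq_nonneg _)
    nlinarith [pow_pos (show (0:ℝ) < ((n + 2 : ℕ) : ℝ) by positivity) 4]
  refine ⟨dF n, genL n B (L + 1), genL_isSymm n B (L + 1), ?_⟩
  have h2 := card_posRoots_ge_gen (B := B) hn hB (L := L) le_rfl
  have e : (L + 1 - 1) * (3 * (n + 2) - 6) + (n + 2) - 1 = 3 * n * L + n + 1 := by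
    rw [show L + 1 - 1 = L by omega, show 3 * (n + 2) - 6 = 3 * n by omega]; ring_nf; omega
  rw [e]; exact h2

end Summit.ValiantsHypothesis.ValiantsHypothesis.Theorems.LacunarySymmetroidMatrixDescartes.VSQ
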